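import Literature.Computability.Learning.NWDesignFP
import Literature.Computability.Learning.LearnerParamsFP
import Literature.Computability.Complexity.PadEvaluation
import Literature.Computability.Complexity.SplitOnesBricks
import Literature.Computability.Complexity.StackBricksStrings
import Literature.Computability.Complexity.UnaryBricks
import HarnessLib

/-!
# The Impagliazzo–Wigderson generator at polynomial stretch, computed ON THE PAD

Machine layer for the remaining half (i) of the discharge of
`Literature.Computability.Complexity.impagliazzoWigderson1998(_samplable)`
(`Complexity/UniformDerandomizationProofs.lean`): the hinge there asks for generators
`G ℓ : {0,1}^{ℓ^{c₀}} → {0,1}^{ℓ^k}` with ONE `F ∈ FP` satisfying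
`F (1^{2^{ℓ^{c₀}}} 0 ⟨1^ℓ, σ⟩) = G ℓ σ`. Following Impagliazzo–Wigderson 1998 / Trevisan–Vadhan 2007
(Thm. 3.9: "a generator `G : {0,1}^{m^b} → {0,1}^m` … computable in time `2^{O(ℓ)}`", with the
Nisan–Wigderson generator of Def. 20.12 / Arora–Barak 2009 on a design of polynomially many blocks),
this file writes that `F` in the tree's brick algebra, on top of

* the explicit polynomial design `cikkDesign q ℓ ℓ'` over `𝔽_q`, `q = prmQ ℓ` the least prime `≥ ℓ`,
  as string functions (`Learning/NWDesignFP.lean`: `restrictFn`, `restrictFn_eq_ofFn_cikkDesign`;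
  `Learning/LearnerParamsFP.lean`: `leastPrimeFn`), with `ℓ' = k (⌊log₂ ℓ⌋ + 1)` so that the
  `ℓ^k < 2^{ℓ'}` output positions index distinct blocks;
* the evaluation of the hard language `H` on the pad (`Complexity/PadEvaluation.lean`:
  `budgetDecideF`, the clocked universal machine with the pad as its unary budget).

Main definitions and results:

* `iwGenF k e` — the string function; **`iwGenF_mem_FP`**;
* `iwGen k e c₀ ℓ σ := iwGenF k e (1^{2^{ℓ^{c₀}}} 0 ⟨1^ℓ, σ⟩)` — the generator family, so that the
  pad equation of the hinge holds BY DEFINITION (`iwGen_pad`);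
* **`iwGenF_apply`** — the value on honest inputs: the list of the hard bits
  `[u_j ∈ H]`, `u_j = z|_{S_{v_j}}` the restriction of the seed `z = σ↾q²` to the `j`-th design block,
  for `j < ℓ^k`, whenever the pad covers the budget of `H`'s decider on `ℓ`-bit inputs.

The identification with `MetaComplexity.nwGenerator` and the asymptotics (the pad covers the
budget for all large `ℓ` when `H ∈ DTIME(2^{n^b})`, `c₀ > b`) are left to the consumer.

## References

* R. Impagliazzo, A. Wigderson, *Randomness vs time: derandomization under a uniform assumption*,
  JCSS 63 (2001) 672–688, §2–3 [ImpagliazzoWigderson2001].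
* L. Trevisan, S. Vadhan, *Pseudorandomness and average-case complexity via uniform reductions*,
  Comput. Complexity 16 (2007), Thm. 3.9, Lemma 3.5 [TrevisanVadhan2007].
* N. Nisan, A. Wigderson, *Hardness vs randomness*, JCSS 49 (1994), §2, Lemma 2.5 [NisanWigderson1994].
* S. Arora, B. Barak, *Computational Complexity: A Modern Approach*, CUP 2009, Def. 20.12–20.13,
  §1.3 [AroraBarakCC2009].
-/

noncomputable section

open Polynomial

namespace Literature.Computability.Learning

open Literature.Computability.Complexity Literature.Computability.Complexity.Brick
  Literature.Computability.Complexity.Plumb Literature.Computability.MetaComplexity _root_.Computability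

namespace IWGen

variable (k : ℕ) (e : List Bool)

/-! ### Parsing the padded input `1^P 0 ⟨1^ℓ, σ⟩` and the parameters -/

/-- The block-index length `ℓ' = k (⌊log₂ ℓ⌋ + 1)` (so that `ℓ^k < 2^{ℓ'}`). [folklore] -/
def lp (ℓ : ℕ) : ℕ := k * (Nat.log 2 ℓ + 1)

/-- `ℓ^k ≤ 2^{ℓ'}`: the `ℓ^k` output indices have distinct `ℓ'`-bit codes. [folklore] -/
theorem pow_le_two_pow_lp (ℓ : ℕ) : ℓ ^ k ≤ 2 ^ lp k ℓ := by
  rw [lp, mul_comm, pow_mul]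
  exact Nat.pow_le_pow_left (Nat.lt_pow_succ_log_self one_lt_two ℓ).le k

/-- The context record `Ctx = ⟨1^P, ⟨1^q, ⟨1^{ℓ'}, ⟨z, 1^ℓ⟩⟩⟩⟩` read off the input
`w = 1^P 0 ⟨1^ℓ, σ⟩`: pad, field size `q = prmQ ℓ` (`leastPrimeFn`), index length `ℓ'`, the seed
prefix `z = σ ↾ q²`, and the block size `ℓ`. [folklore] -/
def ctxF : List Bool → List Bool :=
  fanoutFn onesPrefixFn
    (fanoutFn (leastPrimeFn ∘ fstF ∘ afterZeroFn)
      (fanoutFn (onesMulFn k ∘ List.cons true ∘ logFn ∘ fstF ∘ afterZeroFn)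
        (fanoutFn (takeFn ∘ fanoutFn (HashBricks.umulFn ∘ fanoutFn (leastPrimeFn ∘ fstF ∘ afterZeroFn)
            (leastPrimeFn ∘ fstF ∘ afterZeroFn)) (sndF ∘ afterZeroFn))
          (fstF ∘ afterZeroFn))))

/-- `ctxF ∈ FP`. [folklore] -/
theorem ctxF_mem_FP : ctxF k ∈ FP := by
  have hq : (leastPrimeFn ∘ fstF ∘ afterZeroFn) ∈ FP :=
    comp_mem_FP leastPrimeFn_mem_FP (comp_mem_FP fstF_mem_FP afterZeroFn_mem_FP)
  refine fanoutFn_mem_FP onesPrefixFn_mem_FP (fanoutFn_mem_FP hq (fanoutFn_mem_FP ?_ (fanoutFn_mem_FP ?_ ?_)))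
  · exact comp_mem_FP (onesMulFn_mem_FP k) (comp_mem_FP (cons_mem_FP true)
      (comp_mem_FP logFn_mem_FP (comp_mem_FP fstF_mem_FP afterZeroFn_mem_FP)))
  · exact comp_mem_FP takeFn_mem_FP (fanoutFn_mem_FP (comp_mem_FP HashBricks.umulFn_mem_FP (fanoutFn_mem_FP hq hq))
      (comp_mem_FP sndF_mem_FP afterZeroFn_mem_FP))
  · exact comp_mem_FP fstF_mem_FP afterZeroFn_mem_FP

/-- The honest context record. [folklore] -/
def ctx (P ℓ : ℕ) (σ : List Bool) : List Bool :=
  boolPair (ones P) (boolPair (ones (prmQ ℓ)) (boolPair (ones (lp k ℓ))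
    (boolPair (σ.take (prmQ ℓ * prmQ ℓ)) (ones ℓ))))

/-- Value of `ctxF` on an honest input. [folklore] -/
theorem ctxF_apply (P ℓ : ℕ) (σ : List Bool) :
    ctxF k (ones P ++ false :: boolPair (ones ℓ) σ) = ctx k P ℓ σ := by
  have hℓ : (ones ℓ).length = ℓ := by simp [ones]
  simp only [ctxF, fanoutFn_apply, Function.comp_apply, onesPrefixFn_ones_append, afterZeroFn_ones_append,
    fstF_boolPair, sndF_boolPair, leastPrimeFn_apply, HashBricks.umulFn_boolPair, takeFn_boolPair, ctx]
  congr
  · simp [onesMulFn, logFn, ones, lp]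
  · simp [ones]

/-! ### The output piece: the hard bit of the `j`-th restricted seed -/

/-- The `j`-th block index string: `takeD ℓ' (bin j)` (`j` in binary, little-endian, padded/truncated
to `ℓ'` symbols). [folklore] -/
def vbitsOf (ℓ' j : ℕ) : List Bool := List.takeD ℓ' (encodeNat j) false

/-- `|vbitsOf ℓ' j| = ℓ'`. [folklore] -/
@[simp] theorem length_vbitsOf (ℓ' j : ℕ) : (vbitsOf ℓ' j).length = ℓ' := by simp [vbitsOf]

/-- On `⟨Ctx, 1ʲ⟩`: the design record `⟨⟨[], ⟨1^q, ⟨1^{ℓ'}, ⟨vbits_j, z⟩⟩⟩⟩, 1^ℓ⟩` of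
`NWDesignFP.restrictFn`. [folklore] -/
def recF : List Bool → List Bool :=
  fanoutFn
    (fanoutFn (fun _ => []) (fanoutFn (nthF 1 ∘ fstF) (fanoutFn (nthF 2 ∘ fstF)
      (fanoutFn (fstF ∘ padTakeFn ∘ fanoutFn (nthF 2 ∘ fstF) (lenBinF ∘ sndF)) (nthF 3 ∘ fstF)))))
    (sndF ∘ sndF ∘ sndF ∘ sndF ∘ fstF)

/-- `recF ∈ FP`. [folklore] -/
theorem recF_mem_FP : recF ∈ FP :=
  fanoutFn_mem_FP
    (fanoutFn_mem_FP (const_mem_FP _) (fanoutFn_mem_FP (comp_mem_FP (nthF_mem_FP 1) fstF_mem_FP)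
      (fanoutFn_mem_FP (comp_mem_FP (nthF_mem_FP 2) fstF_mem_FP)
        (fanoutFn_mem_FP (comp_mem_FP fstF_mem_FP (comp_mem_FP padTakeFn_mem_FP
            (fanoutFn_mem_FP (comp_mem_FP (nthF_mem_FP 2) fstF_mem_FP) (comp_mem_FP lenBinF_mem_FP sndF_mem_FP))))
          (comp_mem_FP (nthF_mem_FP 3) fstF_mem_FP)))))
    (comp_mem_FP sndF_mem_FP (comp_mem_FP sndF_mem_FP (comp_mem_FP sndF_mem_FP (comp_mem_FP sndF_mem_FP fstF_mem_FP))))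

/-- Value of `recF`. [folklore] -/
theorem recF_apply (P ℓ : ℕ) (σ : List Bool) (j : ℕ) :
    recF (boolPair (ctx k P ℓ σ) (ones j)) =
      boolPair (designCtx [] (prmQ ℓ) (lp k ℓ) (vbitsOf (lp k ℓ) j) (σ.take (prmQ ℓ * prmQ ℓ))) (ones ℓ) := by
  simp only [recF, ctx, fanoutFn_apply, Function.comp_apply, fstF_boolPair, sndF_boolPair, nthF_succ_boolPair,
    nthF_zero_boolPair, lenBinF_apply, padTakeFn_boolPair, designCtx, vbitsOf]
  simp [ones]

/-- **The output piece** on `⟨Ctx, 1ʲ⟩`: the answer of the clocked universal machine, with the pad as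
budget, on the code word `e` and the restricted seed `u_j = restrictFn (recF …)`.
[cite: TrevisanVadhan2007, Thm. 3.9 (proof: "computing `G_t` … in time `2^{O(t)}`")] -/
def pieceF : List Bool → List Bool :=
  budgetDecideF e ∘ fanoutFn (fstF ∘ fstF) (restrictFn ∘ recF)

/-- `pieceF ∈ FP`. [folklore] -/
theorem pieceF_mem_FP : pieceF e ∈ FP :=
  comp_mem_FP (budgetDecideF_mem_FP e)
    (fanoutFn_mem_FP (comp_mem_FP fstF_mem_FP fstF_mem_FP) (comp_mem_FP restrictFn_mem_FP recF_mem_FP))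

/-- The `j`-th restricted seed (as computed). [folklore] -/
def uOf (ℓ : ℕ) (σ : List Bool) (j : ℕ) : List Bool :=
  restrictFn (boolPair (designCtx [] (prmQ ℓ) (lp k ℓ) (vbitsOf (lp k ℓ) j) (σ.take (prmQ ℓ * prmQ ℓ))) (ones ℓ))

/-- Value of the piece when the pad `1^P` covers the budget of the coded machine on `u_j`.
[folklore] -/
theorem pieceF_apply (P ℓ : ℕ) (σ : List Bool) (j : ℕ) {y : List Bool}
    (hrun : ClockedUS.run (boolPair e (uOf k ℓ σ j)) P = some y) :
    pieceF e (boolPair (ctx k P ℓ σ) (ones j)) = y := by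
  have hP : (ones P).length = P := by simp [ones]
  simp only [pieceF, Function.comp_apply, fanoutFn_apply, fstF_boolPair, recF_apply]
  rw [show fstF (ctx k P ℓ σ) = ones P by simp [ctx]]
  exact budgetDecideF_apply (by rw [hP]; exact hrun)

/-! ### The generator -/

/-- The fold's initial record `⟨Ctx, ⟨bin (ℓ^k), ⟨1⁰, []⟩⟩⟩`. [folklore] -/
def initF : List Bool → List Bool :=
  fanoutFn (ctxF k) (fanoutFn (lenBinF ∘ polyFn (X ^ k) ∘ fstF ∘ afterZeroFn) fun _ => boolPair [] [])

/-- **The IW generator as a string function**: the concatenation over `j < ℓ^k` of the hard bits.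
[cite: TrevisanVadhan2007, Thm. 3.9] [cite: ImpagliazzoWigderson2001, §2] -/
def iwGenF : List Bool → List Bool := sndPow 2 ∘ foldLoop appF (clipF 1 (pieceF e)) (X ^ k) ∘ initF k

/-- **`iwGenF ∈ FP`.** [cite: TrevisanVadhan2007, Thm. 3.9] -/
theorem iwGenF_mem_FP : iwGenF k e ∈ FP :=
  comp_mem_FP (sndPow_mem_FP 2) (comp_mem_FP (foldLoop_clipF_mem_FP 1 appF_mem_FP length_appF_le (pieceF_mem_FP e) _)
    (fanoutFn_mem_FP (ctxF_mem_FP k) (fanoutFn_mem_FP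
      (comp_mem_FP lenBinF_mem_FP (comp_mem_FP (polyFn_mem_FP _) (comp_mem_FP fstF_mem_FP afterZeroFn_mem_FP)))
      (const_mem_FP _))))

/-- **The generator family** `G ℓ σ := iwGenF (1^{2^{ℓ^{c₀}}} 0 ⟨1^ℓ, σ⟩)`. [cite: TrevisanVadhan2007, Thm. 3.9] -/
def iwGen (c₀ ℓ : ℕ) (σ : List Bool) : List Bool :=
  iwGenF k e (ones (2 ^ ℓ ^ c₀) ++ false :: boolPair (ones ℓ) σ)

/-- The pad equation of the hinge holds by definition. [folklore] -/
theorem iwGen_pad (c₀ : ℕ) :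
    ∃ F ∈ FP, ∀ (ℓ : ℕ) (σ : List Bool), σ.length = ℓ ^ c₀ →
      F (ones (2 ^ ℓ ^ c₀) ++ false :: boolPair (ones ℓ) σ) = iwGen k e c₀ ℓ σ :=
  ⟨iwGenF k e, iwGenF_mem_FP k e, fun _ _ _ => rfl⟩

/-- **Value of the generator** on an honest input whose pad covers the budget of the coded machine on
every restricted seed: the list of the `ℓ^k` answers. [cite: TrevisanVadhan2007, Thm. 3.9] -/
theorem iwGenF_apply (P ℓ : ℕ) (σ : List Bool) (y : ℕ → Bool)
    (hrun : ∀ j, j < ℓ ^ k → ClockedUS.run (boolPair e (uOf k ℓ σ j)) P = some [y j]) :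
    iwGenF k e (ones P ++ false :: boolPair (ones ℓ) σ) = ccat (fun j => [y j]) (ℓ ^ k) := by
  have hℓ : (ones ℓ).length = ℓ := by simp [ones]
  have hk : ℓ ^ k ≤ (X ^ k : Polynomial ℕ).eval (ctx k P ℓ σ).length := by
    rw [eval_pow, eval_X]
    refine Nat.pow_le_pow_left ?_ k
    simp only [ctx, length_boolPair]
    have : (ones ℓ).length = ℓ := hℓ
    omega
  have h0 : boolPair ([] : List Bool) [] = boolPair (ones 0) [] := rfl
  simp only [iwGenF, initF, Function.comp_apply, fanoutFn_apply, ctxF_apply, afterZeroFn_ones_append, fstF_boolPair,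
    polyFn_apply, hℓ, lenBinF_apply]
  rw [show (ones ((X ^ k : Polynomial ℕ).eval ℓ)).length = ℓ ^ k by simp [ones], h0, foldLoop_apply appF _ hk 0 _,
    sndPow_succ_boolPair, sndPow_succ_boolPair, sndPow_zero_boolPair,
    foldAcc_clipF (C := 1) (fun j _ hj => by rw [pieceF_apply k e P ℓ σ j (hrun j (by omega))]; simp),
    foldAcc_appF, List.nil_append]
  exact ccat_congr fun j hj => by rw [zero_add, pieceF_apply k e P ℓ σ j (hrun j hj)]

end IWGen

end Literature.Computability.Learning

end
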